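/-
Copyright: cell `langlands-arthur-audit` (papers/Langlands/langlands-arthur-audit), unit `pub-arthur-typer-g17`
(LEAN TYPER gen 17, 2026-08-19).  Staged for the tree under `Literature/NumberTheory/Automorphic/Arthur2013/Leaves/`
(LEAN-IN-TREE rule 2026-08-18); imports `Leaves.DescentLevis` (M55).  Module map: M58 (the packet id; M55 v1 calls this module « M56 », an id taken meanwhile by `Arthur2013/Downstream3`).
-/
import Literature.NumberTheory.Automorphic.Arthur2013.Leaves.DescentLevis

/-!
# Leaves · census of engine L (M55), I: the weighted data of `GL_6 θ_6`, and of `SO_8 ⋊ θ̃` with two `GL`-blocks, kernel-computed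

Companion of `Leaves/DescentLevis` (M55; sources and readings there).  For `d = 6`, every row of M50's tables with
`M̃ ≠ G̃` (a `GL`-block present: `m = dim a_{M̃} ≥ 1`), every configuration and every admissible tag choice (`690`
tagged data on `343` data, in three chunks by block pattern; the rows with `M̃ = G̃` carry `m = 0`, where the only
Levi subgroup with a non-zero coefficient is `L̄ = R̄` itself and the identity consumed is the unweighted one): every
tag choice is `good` (M55 `DTag.good`: the eight consistency checks of the model, `resClean`; an essentially open identity ⇒
M52 `openCapable` and M52's splitting type non-split), and the data admitting an essentially open tag choice are
EXACTLY the `15` listed in `levis6_gl1`, `levis6_gl23`, `levis6_blocks` — against M52's `19` open-capable data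
(`Diagram.predicate_counts`); the `4` others are M55 `levis_vacuous_6`.  By M55 `DTag.scope_of_essOpen`, at each of
the `15` the descended Lie-algebra instance is consumed by [W4] Thm. 3.8 (iii) and lies outside the printed split scope
of [CL II] in the cell's reading.  THIRD CASE, `n = 4`, the rows of TABLE 3 (M51) with two `GL`-blocks (`gl = (1, 1)`,
`(2, 1)`; `344` tagged data): every tag choice is `good` (M55 `OTag.good`) and none is essentially open
(`levisO4_blocks`); the one-block rows are part II (`Leaves/DescentLevisCensusO`, M60).

What is NOT claimed: as in M55; nothing beyond `d = 6`, `n = 4`; the rows with `M̃ = G̃` are not traversed.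
-/

set_option autoImplicit false

namespace Literature.NumberTheory.Automorphic.Arthur2013.Leaves

open NonStd BasePoint Diagram ODiagram

namespace LeviSet

/-- the three chunks and the rows with `M̃ = G̃` exhaust `d = 6`. [folklore] (kernel evaluation) -/
theorem dRows_6_chunks :
    (dRowsFor 6).all (fun x => x.row.gl == [] || x.row.gl == [1] || (x.row.gl == [2] || x.row.gl == [3]) ||
      decide (2 ≤ x.row.gl.length)) = true := by
  decide +kernel

/-- **`d = 6`, Levi `GL_1 × GL_4 × GL_1`** (all `d⁻`, all configurations, all tags): certified, and the essentially
open data are the `9` listed. [folklore] (kernel evaluation) -/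
theorem levis6_gl1 :
    certify ((dRowsFor 6).filter (fun x => x.row.gl == [1])) =
      [(⟨6, [1], 4, 2⟩, [.one, .one, .one], true), (⟨6, [1], 4, 2⟩, [.one, .one, .negOne], true),
       (⟨6, [1], 4, 2⟩, [.one, .one, .gen 0], true), (⟨6, [1], 4, 2⟩, [.negOne, .negOne, .negOne], true),
       (⟨6, [1], 4, 4⟩, [.one, .one, .one], true), (⟨6, [1], 4, 4⟩, [.one, .one, .negOne], true),
       (⟨6, [1], 4, 4⟩, [.one, .one, .gen 0], true), (⟨6, [1], 4, 4⟩, [.one, .negOne, .one], true),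
       (⟨6, [1], 4, 4⟩, [.one, .gen 0, .one], true)] := by
  rw [show (dRowsFor 6).filter (fun x => x.row.gl == [1]) = dRowsWith 6 (fun r => r.gl == [1]) from
      dRowsFor_filter_row 6 (fun r => r.gl == [1])]
  decide +kernel

/-- **`d = 6`, Levi `GL_2 × GL_2 × GL_2` or `GL_3 × GL_3`**: certified, and the essentially open data are the `5`
listed (all on `GL_2 × GL_2 × GL_2`, `d⁻ = 2`). [folklore] (kernel evaluation) -/
theorem levis6_gl23 :
    certify ((dRowsFor 6).filter (fun x => x.row.gl == [2] || x.row.gl == [3])) =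
      [(⟨6, [2], 2, 2⟩, [.one, .one, .one], true), (⟨6, [2], 2, 2⟩, [.one, .negOne, .one], true),
       (⟨6, [2], 2, 2⟩, [.one, .gen 0, .one], true), (⟨6, [2], 2, 2⟩, [.negOne, .one, .one], true),
       (⟨6, [2], 2, 2⟩, [.gen 0, .one, .one], true)] := by
  rw [show (dRowsFor 6).filter (fun x => x.row.gl == [2] || x.row.gl == [3]) = dRowsWith 6 (fun r => r.gl == [2] || r.gl == [3]) from
      dRowsFor_filter_row 6 (fun r => r.gl == [2] || r.gl == [3])]
  decide +kernel

/-- **`d = 6`, two or more `GL`-blocks** (`GL_1 × GL_1 × GL_2 × GL_1 × GL_1`, `GL_1 × GL_2 × GL_2 × GL_1`, `GL_2 ×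
GL_1 × GL_1 × GL_2`, `GL_1^6`): certified, and exactly ONE essentially open datum, `GL_1 × GL_1 × GL_2 × GL_1 × GL_1`,
`d⁻ = 2`, `y = (1, 1, 1)`. [folklore] (kernel evaluation) -/
theorem levis6_blocks :
    certify ((dRowsFor 6).filter (fun x => decide (2 ≤ x.row.gl.length))) =
      [(⟨6, [1, 1], 2, 2⟩, [.one, .one, .one], true)] := by
  rw [show (dRowsFor 6).filter (fun x => decide (2 ≤ x.row.gl.length)) = dRowsWith 6 (fun r => decide (2 ≤ r.gl.length)) from
      dRowsFor_filter_row 6 (fun r => decide (2 ≤ r.gl.length))]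
  decide +kernel

/-- **`n = 4`, two `GL`-blocks** (`gl = (1, 1)` or `(2, 1)`): certified, nothing essentially open.
[folklore] (kernel evaluation) -/
theorem levisO4_blocks :
    certifyO ((odRowsFor 4).filter (fun x => x.row.gl == [1, 1] || x.row.gl == [2, 1])) = [] := by
  rw [show (odRowsFor 4).filter (fun x => x.row.gl == [1, 1] || x.row.gl == [2, 1]) = odRowsWith 4 (fun r => r.gl == [1, 1] || r.gl == [2, 1]) from
      odRowsFor_filter_row 4 (fun r => r.gl == [1, 1] || r.gl == [2, 1])]
  decide +kernel

/-- the `15` weighted data `(row, configuration)` of `GL_6 θ_6` admitting an essentially open tag choice (every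
tag choice at every `d = 6` datum with `M̃ ≠ G̃` being `good`), read off `levis6_gl1`, `levis6_gl23`,
`levis6_blocks`; M52's four other open-capable data are M55 `levis_vacuous_6`. [folklore] (executable list) -/
def essential6 : List (Row × Config) :=
  [(⟨6, [1], 4, 2⟩, [.one, .one, .one]), (⟨6, [1], 4, 2⟩, [.one, .one, .negOne]),
   (⟨6, [1], 4, 2⟩, [.one, .one, .gen 0]), (⟨6, [1], 4, 2⟩, [.negOne, .negOne, .negOne]),
   (⟨6, [1], 4, 4⟩, [.one, .one, .one]), (⟨6, [1], 4, 4⟩, [.one, .one, .negOne]),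
   (⟨6, [1], 4, 4⟩, [.one, .one, .gen 0]), (⟨6, [1], 4, 4⟩, [.one, .negOne, .one]),
   (⟨6, [1], 4, 4⟩, [.one, .gen 0, .one]), (⟨6, [2], 2, 2⟩, [.one, .one, .one]),
   (⟨6, [2], 2, 2⟩, [.one, .negOne, .one]), (⟨6, [2], 2, 2⟩, [.one, .gen 0, .one]),
   (⟨6, [2], 2, 2⟩, [.negOne, .one, .one]), (⟨6, [2], 2, 2⟩, [.gen 0, .one, .one]),
   (⟨6, [1, 1], 2, 2⟩, [.one, .one, .one])]

/-- **census `d = 6`**: over the three chunks (all rows with `M̃ ≠ G̃`, cf. `dRows_6_chunks`) the data returned by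
`certify` are exactly `essential6`, each with the flag « every tag choice good ». [folklore] (kernel evaluation) -/
theorem census6 :
    certify ((dRowsFor 6).filter (fun x => x.row.gl == [1])) ++
      (certify ((dRowsFor 6).filter (fun x => x.row.gl == [2] || x.row.gl == [3])) ++
        certify ((dRowsFor 6).filter (fun x => decide (2 ≤ x.row.gl.length)))) =
      essential6.map (fun p => (p.1, p.2, true)) := by
  rw [levis6_gl1, levis6_gl23, levis6_blocks]; decide

end LeviSet

end Literature.NumberTheory.Automorphic.Arthur2013.Leaves
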